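import Summits.Ventures.YMGap.Census.WindowIntegration
import Summits.Ventures.LatticeQCDFlow.Exactness.CompactHaar
import HarnessLib

/-!
# Venture YMGap, track (b) — Tomboulis's Prop. III.1 (the potential-moving UPPER BOUND, arXiv:0707.2179 (3.4)/(A.19))
# as a tree theorem on the positivity domain: coarse-graining and assembly

HONEST FRAMING: venture file of the cell `pub-ymgap` (QuantumFields programme), track (b); finite tori only.  The theorem
below is ONE decimation step `(ℤ/bLℤ)^d → (ℤ/Lℤ)^d` of Tomboulis's Prop. III.1 at `r = 1`, for every `d`, `b ≥ 1`, `L ≥ 1`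
and spin cut-off `J`, for admissible coefficients `0 ≤ c_j ≤ 1` whose plaquette function is NON-NEGATIVE on `SU(2)`
(Tomboulis's standing hypothesis (2.34) `f_p(U, n) > 0`, under which alone the action of App. A §4 exists).  The typed
`Tomboulis2007.DecimationUpperBound d L b J r` quantifies over all admissible `c`, including truncated plaquette
functions that change sign; that remains a census question (cell item C3).  Nothing here concerns (5.15), limits,
confinement or a mass gap.

* `cLink`, `cw`, `cwConfig` — the `b` fine links of a coarse link and their ordered product; `coarseWord_eq_holonomy`:
  the boundary word of a merged window is the coarse plaquette holonomy of `cwConfig`.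
* `integral_eq_integral_update_mul` — substitution `U_e ↦ U_e · T(U)` inside the product Haar integral (right invariance
  on the slice); `integral_comp_cwS` — substituting `u_0 ↦ u_0 (u_1⋯u_{b-1})⁻¹` on every coarse link replaces the words
  `u_0 u_1 ⋯ u_{b-1}` by `u_0`; `measurePreserving_compCLink` — reading one fine link per coarse link pushes the fine
  product Haar measure to the coarse one.  Together: `∫ G(cwConfig U) dU = ∫ G(V) dV` (`integral_comp_cwConfig`).
* **`decimationUpperBound_of_nonneg`** —
  `Z_{(ℤ/bL)^d}({c_j}) ≤ F₀^U(1)^{|Λ^{(1)}|} · Z_{(ℤ/L)^d}({c^U_j(1,1)})`, `|Λ^{(1)}|` the number of coarse plaquettes,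
  `F₀^U = F̂₀^{b²}`, `c^U_j = ĉ_j^{b²}`, `ζ = b^{d-2}` — Prop. III.1 (3.4) at `r = 1` AS PRINTED, from
  `PotentialMoving.torusZ_fine_le_powFieldZ_mkExp` (the inequality) and the exact integrations
  (`WindowGeometry`, `WindowIntegration`, this file).

References: E. T. Tomboulis, arXiv:0707.2179, Prop. III.1 eq. (3.4), §2.1 (RG1)–(RG5), App. A §4 (A.14)–(A.19)
[cite: Tomboulis2007Confinement, Prop. III.1]; A. A. Migdal, Sov. Phys. JETP 42 (1975) 413; L. P. Kadanoff, Ann. Phys. 100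
(1976) 359 [folklore].
-/

noncomputable section

open MeasureTheory Finset Real Function
open scoped BigOperators
open Literature.MathematicalPhysics.QuantumLattice
open Literature.MathematicalPhysics.QuantumFieldTheory
open Literature.MathematicalPhysics.QuantumFieldTheory.Tomboulis2007
open Literature.MathematicalPhysics.QuantumFieldTheory.WilsonRP
open Summit.Ventures.LatticeQCDFlow.Exactness
open Summit.Ventures.LatticeQCDFlow.Scoring

namespace Summit.Ventures.YMGap.Census

variable {d L : ℕ} (b : ℕ)

/-! ### Coarse links as words of fine links -/

/-- The `s`-th fine link of the coarse link `E = (y, μ)`: `(b·y + s e_μ, μ)`. -/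
def cLink (E : Edge d L) (s : ℕ) : Edge d (b * L) := (corner b E.1 + Pi.single E.2 (s : ZMod (b * L)), E.2)

/-- The coarse link word `u_0 u_1 ⋯ u_{b-1}`. -/
def cw (E : Edge d L) (W : GaugeConfig d (b * L) SU2) : SU2 := prodA (fun s W => W (cLink b E s)) (b - 1) W

/-- The tail `u_1 ⋯ u_{b-1}` of the coarse link word. -/
def cwRest (E : Edge d L) (W : GaugeConfig d (b * L) SU2) : SU2 :=
  ((List.range (b - 1)).map fun i => W (cLink b E (i + 1))).prod

/-- The coarse configuration read off a fine one: every coarse link carries its word. -/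
def cwConfig (W : GaugeConfig d (b * L) SU2) : GaugeConfig d L SU2 := fun E => cw b E W

/-- Partially substituted coarse configuration: the links in `S` carry their first fine link, the others their word. -/
def cwS (S : Finset (Edge d L)) (W : GaugeConfig d (b * L) SU2) : GaugeConfig d L SU2 :=
  fun E => if E ∈ S then W (cLink b E 0) else cw b E W

/-- The coarse torus integrand `∏_P Σ_m A_m χ_m(V_P)`. -/
def torusFn [NeZero L] (K : ℕ) (A : ℕ → ℝ) (V : GaugeConfig d L SU2) : ℝ :=
  ∏ P : Plaquette d L, faceSum K A (plaquetteHolonomy V P.1 P.2.1.1 P.2.1.2)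

variable {b}

/-- `u_0 u_1 ⋯ u_{b-1} = u_0 · (u_1 ⋯ u_{b-1})`. -/
theorem cw_eq_head_mul (E : Edge d L) (W : GaugeConfig d (b * L) SU2) : cw b E W = W (cLink b E 0) * cwRest b E W := by
  unfold cw cwRest prodA
  rw [List.range_succ_eq_map, List.map_cons, List.prod_cons, List.map_map]
  rfl

section Geometry

variable [NeZero b] [NeZero L]

/-- The corner of a shifted coarse site: `b·(y + e_ν) = b·y + b e_ν`. -/
theorem corner_shift (y : Site d L) (ν : Fin d) : corner b (y.shift ν) = corner b y + Pi.single ν (b : ZMod (b * L)) := by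
  funext κ
  simp only [corner, Site.shift, Pi.add_apply, scale_add]
  by_cases h : κ = ν
  · subst h; rw [Pi.single_eq_same, Pi.single_eq_same, scale_one]
  · rw [Pi.single_eq_of_ne h, Pi.single_eq_of_ne h, scale_zero]

omit [NeZero b] [NeZero L] in
/-- Bottom row links are the fine links of the coarse link `(y, μ)`. -/
theorem hLink_zero (P : Plaquette d L) (s : ℕ) : hLink b P s 0 = cLink b (P.1, P.2.1.1) s := by
  simp [hLink, cLink, base]

omit [NeZero b] [NeZero L] in
/-- Left column links are the fine links of the coarse link `(y, ν)`. -/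
theorem vLink_zero (P : Plaquette d L) (t : ℕ) : vLink b P 0 t = cLink b (P.1, P.2.1.2) t := by
  simp [vLink, cLink, base]

/-- Top row links are the fine links of the coarse link `(y + e_ν, μ)`. -/
theorem hLink_top (P : Plaquette d L) (s : ℕ) : hLink b P s b = cLink b (P.1.shift P.2.1.2, P.2.1.1) s := by
  unfold hLink cLink base
  rw [corner_shift, add_right_comm]

/-- Right column links are the fine links of the coarse link `(y + e_μ, ν)`. -/
theorem vLink_top (P : Plaquette d L) (t : ℕ) : vLink b P b t = cLink b (P.1.shift P.2.1.1, P.2.1.2) t := by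
  unfold vLink cLink base
  rw [corner_shift]

/-- **The boundary word of a merged window is the coarse plaquette holonomy of the word configuration.** -/
theorem coarseWord_eq_holonomy (P : Plaquette d L) (W : GaugeConfig d (b * L) SU2) :
    coarseWord b P W = plaquetteHolonomy (cwConfig b W) P.1 P.2.1.1 P.2.1.2 := by
  have h1 : hRow b P 0 W = cw b (P.1, P.2.1.1) W := by
    unfold hRow cw rowA; simp only [hLink_zero]
  have h2 : hRow b P b W = cw b (P.1.shift P.2.1.2, P.2.1.1) W := by
    unfold hRow cw rowA; simp only [hLink_top]
  have h3 : vCol b P 0 W = cw b (P.1, P.2.1.2) W := by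
    unfold vCol cw; simp only [vLink_zero]
  have h4 : vCol b P b W = cw b (P.1.shift P.2.1.1, P.2.1.2) W := by
    unfold vCol cw; simp only [vLink_top]
  simp only [coarseWord, plaquetteHolonomy, cwConfig, h1, h2, h3, h4]

/-- Fine links of coarse links are distinct unless they are the same (`s, s' < b`). -/
theorem cLink_inj {E E' : Edge d L} {s s' : ℕ} (hs : s < b) (hs' : s' < b) (h : cLink b E s = cLink b E' s') :
    E = E' ∧ s = s' := by
  simp only [cLink, Prod.mk.injEq] at h
  obtain ⟨hX, hμ⟩ := h
  rw [← hμ] at hX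
  have hμc := congrFun hX E.2
  simp only [Pi.add_apply, corner, Pi.single_eq_same] at hμc
  obtain ⟨hy, hss⟩ := (scale_add_natCast_eq_iff hs hs').1 hμc
  refine ⟨Prod.ext (funext fun κ => ?_) hμ, hss⟩
  by_cases hκ : κ = E.2
  · rw [hκ]; exact hy
  · have h1 := congrFun hX κ
    simp only [Pi.add_apply, corner, Pi.single_eq_of_ne hκ, add_zero] at h1
    exact scale_injective h1

/-- The tail links of a coarse link are not its head link. -/
theorem cLink_succ_ne_zero (E : Edge d L) {i : ℕ} (hi : i + 1 < b) : cLink b E (i + 1) ≠ cLink b E 0 := fun h =>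
  absurd (cLink_inj hi (by omega) h).2 (by omega)

/-- The tail word ignores updates at the head link. -/
theorem cwRest_update_head (E : Edge d L) (W : GaugeConfig d (b * L) SU2) (g : SU2) :
    cwRest b E (update W (cLink b E 0) g) = cwRest b E W := by
  unfold cwRest
  congr 1
  refine List.map_congr_left fun i hi => update_of_ne (cLink_succ_ne_zero E ?_) _ _
  have := List.mem_range.1 hi; omega

/-- Another coarse link's word ignores updates at the head link of `E`. -/
theorem cw_update_of_ne {E E' : Edge d L} (hE : E' ≠ E) (W : GaugeConfig d (b * L) SU2) (g : SU2) :
    cw b E' (update W (cLink b E 0) g) = cw b E' W := by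
  unfold cw
  refine prodA_update_le (fun i hi U g' => update_of_ne (fun h => hE ?_) _ _) W g
  have hb : 1 ≤ b := Nat.one_le_iff_ne_zero.2 (NeZero.ne b)
  exact (cLink_inj (by omega) (by omega) h).1

/-- **The substitution `u_0 ↦ u_0 (u_1⋯u_{b-1})⁻¹` on the coarse link `E ∉ S`** turns `cwS S` into `cwS (insert E S)`. -/
theorem cwS_subst {S : Finset (Edge d L)} {E : Edge d L} (hE : E ∉ S) (W : GaugeConfig d (b * L) SU2) :
    cwS b S (update W (cLink b E 0) (W (cLink b E 0) * (cwRest b E W)⁻¹)) = cwS b (insert E S) W := by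
  funext E'
  unfold cwS
  by_cases h : E' = E
  · subst h
    rw [if_neg hE, if_pos (Finset.mem_insert_self _ _), cw_eq_head_mul, update_self, cwRest_update_head,
      inv_mul_cancel_right]
  · simp only [Finset.mem_insert, h, false_or]
    split_ifs with h'
    · exact update_of_ne (fun h'' => h (cLink_inj (Nat.pos_of_ne_zero (NeZero.ne b))
        (Nat.pos_of_ne_zero (NeZero.ne b)) h'').1) _ _
    · exact cw_update_of_ne h W _

omit [NeZero b] [NeZero L] in
/-- `cwS ∅ = cwConfig`. -/
theorem cwS_empty (W : GaugeConfig d (b * L) SU2) : cwS b (∅ : Finset (Edge d L)) W = cwConfig b W := by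
  funext E; simp [cwS, cwConfig]

omit [NeZero b] in
/-- `cwS univ` reads one fine link per coarse link. -/
theorem cwS_univ (W : GaugeConfig d (b * L) SU2) : cwS b (Finset.univ : Finset (Edge d L)) W = fun E => W (cLink b E 0) := by
  funext E; simp [cwS]

omit [NeZero b] [NeZero L] in
/-- `cwS S` is continuous. -/
theorem continuous_cwS (S : Finset (Edge d L)) : Continuous (cwS (L := L) b S) := by
  refine continuous_pi fun E => ?_
  by_cases h : E ∈ S
  · simp only [cwS, if_pos h]; exact continuous_apply _
  · simp only [cwS, if_neg h]; unfold cw; exact continuous_prodA (fun s => continuous_apply _) _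

end Geometry

/-! ### Substitution inside the product Haar integral -/

section Subst

variable {N : ℕ} [NeZero N]

/-- **Link substitution** `U_e ↦ U_e · T(U)` (with `T` not reading `e`) does not change a product Haar integral
(right invariance of the Haar probability on the slice `U_e`). -/
theorem integral_eq_integral_update_mul (e : Edge d N) {T : GaugeConfig d N SU2 → SU2} (hT : ∀ U g, T (update U e g) = T U)
    (hTc : Continuous T) {F : GaugeConfig d N SU2 → ℝ} (hF : Continuous F) :
    ∫ U, F U ∂(Measure.pi fun _ : Edge d N => haarProbability SU2) =
      ∫ U, F (update U e (U e * T U)) ∂(Measure.pi fun _ : Edge d N => haarProbability SU2) := by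
  have hF' : Continuous fun U : GaugeConfig d N SU2 => F (update U e (U e * T U)) :=
    hF.comp (continuous_id.update e ((continuous_apply e).mul hTc))
  rw [integral_pi_eq_integral_update (haarProbability SU2) e (integrable_pi_su2_of_continuous hF),
    integral_pi_eq_integral_update (haarProbability SU2) e (integrable_pi_su2_of_continuous hF')]
  refine integral_congr_ae (ae_of_all _ fun w => ?_)
  simp only [update_self, update_idem, hT]
  exact (integral_mul_right_eq_self (fun g => F (update w e g)) (T w)).symm

end Subst

section CoarseGraining

variable [NeZero b] [NeZero L]

/-- **Substituting on every coarse link**: `∫ G(cwConfig U) dU = ∫ G(cwS S U) dU` for every `S`. -/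
theorem integral_comp_cwS {G : GaugeConfig d L SU2 → ℝ} (hG : Continuous G) (S : Finset (Edge d L)) :
    ∫ W, G (cwConfig b W) ∂(Measure.pi fun _ : Edge d (b * L) => haarProbability SU2) =
      ∫ W, G (cwS b S W) ∂(Measure.pi fun _ : Edge d (b * L) => haarProbability SU2) := by
  induction S using Finset.induction_on with
  | empty => simp only [cwS_empty]
  | insert E S hE ih =>
    rw [ih, integral_eq_integral_update_mul (cLink b E 0) (T := fun W => (cwRest b E W)⁻¹)
      (fun U g => by simp only [cwRest_update_head]) ?_ (F := fun W => G (cwS b S W)) (hG.comp (continuous_cwS S))]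
    · simp only [cwS_subst hE]
    · unfold cwRest
      exact (continuous_list_prod _ fun i _ => continuous_apply (cLink b E (i + 1))).inv

/-- **Reading one fine link per coarse link pushes the fine product Haar measure to the coarse one.** -/
theorem measurePreserving_compCLink :
    MeasurePreserving (fun W : GaugeConfig d (b * L) SU2 => fun E : Edge d L => W (cLink b E 0))
      (Measure.pi fun _ : Edge d (b * L) => haarProbability SU2) (Measure.pi fun _ : Edge d L => haarProbability SU2) := by
  have hb : 0 < b := Nat.pos_of_ne_zero (NeZero.ne b)
  have hj : Function.Injective fun E : Edge d L => cLink b E 0 := fun E E' h => (cLink_inj hb hb h).1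
  have hmeas : Measurable fun W : GaugeConfig d (b * L) SU2 => fun E : Edge d L => W (cLink b E 0) :=
    measurable_pi_lambda _ fun E => measurable_pi_apply _
  refine ⟨hmeas, (Measure.pi_eq fun s hs => ?_).symm⟩
  rw [Measure.map_apply hmeas (MeasurableSet.univ_pi hs)]
  classical
  let t : Edge d (b * L) → Set SU2 := fun e => if h : ∃ E, cLink b E 0 = e then s (Classical.choose h) else Set.univ
  have hchoose : ∀ E : Edge d L, ∀ h : ∃ E', cLink b E' 0 = cLink b E 0, Classical.choose h = E :=
    fun E h => hj (Classical.choose_spec h)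
  have ht : ∀ E : Edge d L, t (cLink b E 0) = s E := by
    intro E
    have h : ∃ E', cLink b E' 0 = cLink b E 0 := ⟨E, rfl⟩
    simp only [t, dif_pos h, hchoose E h]
  have hpre : (fun W : GaugeConfig d (b * L) SU2 => fun E : Edge d L => W (cLink b E 0)) ⁻¹' Set.pi Set.univ s =
      Set.pi Set.univ t := by
    ext W
    simp only [Set.mem_preimage, Set.mem_univ_pi]
    constructor
    · intro h e
      by_cases he : ∃ E, cLink b E 0 = e
      · obtain ⟨E, rfl⟩ := he
        rw [ht]; exact h E
      · simp only [t, dif_neg he, Set.mem_univ]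
    · intro h E
      rw [← ht]; exact h _
  rw [hpre, Measure.pi_pi]
  rw [← Finset.prod_subset (Finset.subset_univ (Finset.univ.image fun E : Edge d L => cLink b E 0))
    (fun e _ he => by
      have he' : ¬ ∃ E, cLink b E 0 = e := fun ⟨E, hE⟩ => he (Finset.mem_image.2 ⟨E, Finset.mem_univ _, hE⟩)
      simp only [t, dif_neg he', measure_univ]),
    Finset.prod_image fun E _ E' _ h => hj h]
  exact Finset.prod_congr rfl fun E _ => by rw [ht]

/-- **Coarse-graining**: `∫ G(cwConfig U) dU_fine = ∫ G(V) dV_coarse` for continuous `G`. -/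
theorem integral_comp_cwConfig {G : GaugeConfig d L SU2 → ℝ} (hG : Continuous G) :
    ∫ W, G (cwConfig b W) ∂(Measure.pi fun _ : Edge d (b * L) => haarProbability SU2) =
      ∫ V, G V ∂(Measure.pi fun _ : Edge d L => haarProbability SU2) := by
  haveI : SecondCountableTopology SU2 := Summit.Ventures.LatticeQCDFlow.Scoring.secondCountableTopology_su2
  rw [integral_comp_cwS hG Finset.univ]
  simp only [cwS_univ]
  have hπ := measurePreserving_compCLink (d := d) (L := L) (b := b)
  have h := integral_map (μ := Measure.pi fun _ : Edge d (b * L) => haarProbability SU2) (f := G)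
    hπ.measurable.aemeasurable hG.aestronglyMeasurable
  rw [hπ.map_eq] at h
  exact h.symm

end CoarseGraining

/-! ### Assembly: Prop. III.1 at `r = 1` on the positivity domain -/

section Assembly

variable [NeZero b] [NeZero L]

omit [NeZero L] in
/-- Merging `k + 1` faces of a plaquette function gives a plaquette function: `(d_j c_j)^{k+1}/d_j^k = d_j c_j^{k+1}`. -/
theorem mergeCoef_stdCoef (c : ℕ → ℝ) (k : ℕ) : mergeCoef (stdCoef c) k = stdCoef fun n => c n ^ (k + 1) := by
  funext m
  unfold mergeCoef stdCoef
  split_ifs with hm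
  · subst hm; simp
  · have h : ((m : ℝ) + 1) ≠ 0 := by positivity
    rw [mul_pow, pow_succ ((m : ℝ) + 1) k]
    field_simp

omit [NeZero L] in
/-- **The merged window of a plaquette function is the decimated plaquette function**: `cellCoef (stdCoef ĉ) = stdCoef (ĉ^{b²})`. -/
theorem cellCoef_stdCoef (c : ℕ → ℝ) : cellCoef b (stdCoef c) = stdCoef fun n => c n ^ (b ^ 2) := by
  unfold cellCoef
  rw [mergeCoef_stdCoef, mergeCoef_stdCoef, sub_one_add_one_b]
  congr 1
  funext n
  rw [← pow_mul, sq]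

/-- The coarse torus integrand of `stdCoef c'` integrates to `Z_{(ℤ/L)^d}({c'_j})`. -/
theorem integral_torusFn_stdCoef (K : ℕ) (c' : ℕ → ℝ) :
    ∫ V, torusFn K (stdCoef c') V ∂(Measure.pi fun _ : Edge d L => haarProbability SU2) = torusZ d L K c' := by
  unfold torusFn torusZ
  refine integral_congr_ae (ae_of_all _ fun V => Finset.prod_congr rfl fun P _ => ?_)
  rw [plaqFn_hol_eq_fR, fR_eq_faceSum]

/-- `torusFn` is continuous. -/
theorem continuous_torusFn (K : ℕ) (A : ℕ → ℝ) : Continuous (torusFn (d := d) (L := L) K A) := by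
  unfold torusFn
  refine continuous_finsetProd _ fun P _ => (continuous_faceSum K A).comp ?_
  unfold plaquetteHolonomy
  fun_prop

/-- **Tomboulis's Prop. III.1 (arXiv:0707.2179 (3.4), App. A (A.19)) at `r = 1` on the positivity domain.**
One potential-moving decimation `(ℤ/bLℤ)^d → (ℤ/Lℤ)^d` with `ζ = b^{d-2}` bounds the normalised partition function above:
`Z_{(ℤ/bL)^d}({c_j}) ≤ F₀^U(1)^{|Λ^{(1)}|} · Z_{(ℤ/L)^d}({c^U_j(1,1)})`, `|Λ^{(1)}|` the number of coarse plaquettes, for every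
`d`, `b ≥ 1`, `L ≥ 1`, cut-off `J`, and admissible `c` with `f_c ≥ 0` on `SU(2)`. -/
theorem decimationUpperBound_of_nonneg (J : ℕ) {c : ℕ → ℝ} (hc : CoeffAdmissible c) (hf : ∀ g : SU2, 0 ≤ plaqFn J c g) :
    torusZ d (b * L) J c ≤
      mkF0 J c (b ^ (d - 2)) b ^ Fintype.card (Plaquette d L) *
        torusZ d L (b ^ (d - 2) * J) (mkCoeff J c (b ^ (d - 2)) b 1) := by
  have hc' : ∀ n, 1 ≤ n → 0 ≤ c n := fun n hn => (hc n hn).1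
  -- the inequality: potential moving
  refine (torusZ_fine_le_powFieldZ_mkExp b J hf).trans (le_of_eq ?_)
  -- the exact integrations
  rw [powFieldZ_mkExp_eq J hc' (b ^ (d - 2)), integral_windowFn_eq_prod_mergedFace]
  have hG : ∀ W : GaugeConfig d (b * L) SU2, ∏ P : Plaquette d L,
      mergedFace b (b ^ (d - 2) * J) (stdCoef (hatCoeff J c (b ^ (d - 2)))) P W =
      torusFn (b ^ (d - 2) * J) (stdCoef (mkCoeff J c (b ^ (d - 2)) b 1)) (cwConfig b W) := by
    intro W
    have hco : mkCoeff J c (b ^ (d - 2)) b 1 = fun n => hatCoeff J c (b ^ (d - 2)) n ^ (b ^ 2) :=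
      funext fun n => mkCoeff_one_eq_pow J c _ b n
    rw [hco, ← cellCoef_stdCoef]
    unfold torusFn mergedFace
    simp only [coarseWord_eq_holonomy]
  simp_rw [hG]
  rw [integral_comp_cwConfig (continuous_torusFn _ _), integral_torusFn_stdCoef]
  unfold mkF0
  rw [← pow_mul, mul_comm (b ^ 2)]

end Assembly

end Summit.Ventures.YMGap.Census

end
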